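import Literature.Computability.AlgebraicComplexity.ChowNormalization
import Mathlib.LinearAlgebra.Vandermonde
import HarnessLib

/-!
# Explicit highest-weight vectors in `𝒪(V^m // H_m) = ⊕_δ Sym^m Sym^δ V^*`

Setting of `ChowPullback.lean` … `ChowNormalization.lean` (`k[Mat_m] = MvPolynomial (Fin m × Fin m) k`
with the action `formsRep m` of `GL_m`, `(g·G)(w) = G(g⁻¹ w)`; upper triangular Borel subgroup and
weights as in `Literature/NumberTheory/DiophantineGeometry/GLHighestWeight.lean`).

We construct the highest-weight vectors ("`U`-invariants", `B`-semi-invariants) of `k[Mat_m]`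
needed for Bürgisser–Hüttenhain–Ikenmeyer's Theorem 3 (Proc. AMS 145 (2017), §3, Props. 2–3):

* `lastMinor m hr c`, the `r × r` minor of the generic matrix on the LAST `r` variable indices and
  the forms `c 0, …, c (r-1)`: a highest-weight vector of weight `lastWeight m r = -𝟙_{≥ m-r}`
  (`lastMinor_mem_highestWeightSpace`), i.e. of dual weight the fundamental weight
  `ω_r = 𝟙_{< r}` (`dual_lastWeight`); products of such have the dual weight of the partition whose
  columns have the lengths `r` (the classical description of `U`-invariants of `⊗ Sym`, cf.
  BHI §3, proof of Lemma 5: "`v^{⊗ℓk}` ... is a highest weight vector of weight `(1 × ℓk)`").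
* the algebra of highest-weight vectors: products, powers, sums, column permutations
  (`mul_mem_highestWeightSpace_formsRep`, …), and their column degrees (`formCount`).
* evaluation of minors at points (`eval_lastMinor`), used in the second part of this file to
  certify that the symmetrised products realising BHI's generators
  `(2n-2,2)`, `(3n-3,3)`, `λ^{(k)}` (Lemma 6) and the cone generators are NONZERO.

## Part II: explicit symmetric highest-weight vectors — BHI's generators realised

Setting as above. A weight `ψ` of `GL_m` is REALISED in degree `δ`
(`IsRealized k m δ ψ`) if `𝒪(V^m // H_m)_δ = symBalanced m δ` contains a nonzero highest-weight
vector of weight `ψ` for `formsRep m` (so that, in the language of Bürgisser–Hüttenhain–Ikenmeyer,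
Proc. AMS 145 (2017), §3, Lemma 4, the DUAL weight `ψ^*` — a partition — lies in
`S(V^m // H_m)`: "`V_G(λ)` occurs in `Sym^n Sym^{|λ|/n} ℂ^n`"). Realised weights form a monoid
(`IsRealized.mul`).

We realise, by explicit symmetrised products of minors of the generic matrix whose nonvanishing is
certified by EVALUATION at an explicit point:

* `isRealized_coneGen`: `2m · (-𝟙_{≥ m-r})`, dual weight `2m · ω_r = 2m · (1^r)`, for `1 ≤ r ≤ m`
  — in degree `2r`, by `∑_τ τ·(∏_s Δ_r(s, s+1, …, s+r-1))²` (cyclic intervals of forms), nonzero at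
  a Vandermonde point (a sum of squares of nonzero integers); these give the rational CONE of BHI
  Prop. 2 (every partition with at most `m` rows is a nonnegative combination of the `ω_r`);
* `isRealized_genK`: BHI's `λ^{(k)}` of Lemma 6 (`2 ≤ k ≤ m`; for `k = 2` the partition
  `(2m-2, 2)`), dual weight `ω_k + C(k,2) ω_2 + (m-k)k ω_1`, in degree `k`, by
  `∑_τ τ·(Δ_k(0,…,k-1) · ∏_{a<b<k} Δ_2(a,b) · ∏_{j ≥ k} x_j^k)`, nonzero at a Vandermonde point
  (again a sum of positive integers: the `k × k` Vandermonde determinant times the product of the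
  `2 × 2` ones is a square);
* `isRealized_gen3`: the partition `(3m-3, 3)` (`m ≥ 3`), dual weight `3 ω_2 + (3m-6) ω_1`, in
  degree `3`, by `∑_τ τ·(Δ_2(0,1)² Δ_2(0,2) x_1 x_2² ∏_{j≥3} x_j³)`, nonzero at a `0/1`-point
  (exactly the `τ` fixing the form `0` contribute, each by `1`).

Here `Δ_r(c) = lastMinor m _ c` is the minor on the last `r` variable indices and `x_j = Δ_1(j)`.
In print (BHI, proof of Prop. 3): "Using the Schur program we checked that `(2,2,0…,0)` occurs in
`Sym^2Sym^2 V` and `(6,3,0,…,0)` occurs in `Sym^3Sym^3V`", Lemma 5 (multiplication by powers of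
the highest-weight vector), Lemma 6 (via inheritance and Manivel–Michałek); the explicit vectors
above replace these citations by a direct verification valid for every `m`.

## References

* [BurgisserHuttenhainIkenmeyer2017] §3 (Lemma 4, Lemma 5, Lemma 6, Props. 2–3).
* W. Fulton, J. Harris, *Representation Theory*, §15.5 (highest-weight vectors as products of
  minors). [folklore]
-/

noncomputable section

open MvPolynomial
open scoped Matrix

namespace Literature.Computability.AlgebraicComplexity

open Literature.NumberTheory.DiophantineGeometry

variable {k : Type*} [Field k] (m : ℕ)

/-! ### The algebra of highest-weight vectors of `formsRep` -/

/-- The weight character of a multiple of a weight. [folklore] -/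
theorem weightChar_nsmul {σ : Type*} [Fintype σ] [LinearOrder σ] (n : ℕ) (χ : Weight σ)
    {b : GL σ k} (hb : IsUpperTriangular b) : weightChar (n • χ) b = weightChar χ b ^ n := by
  induction n with
  | zero =>
    rw [zero_smul, pow_zero, weightChar]
    exact Finset.prod_eq_one fun i _ => by rw [Pi.zero_apply, zpow_zero]
  | succ n ih => rw [succ_nsmul, weightChar_add _ _ hb, ih, pow_succ]

variable {m}

/-- **Highest-weight vectors of `k[Mat_m]` multiply, weights adding** (`formsRep g` is an algebra
homomorphism). [folklore] -/
theorem mul_mem_highestWeightSpace_formsRep {χ χ' : Weight (Fin m)}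
    {F G : MvPolynomial (Fin m × Fin m) k} (hF : F ∈ highestWeightSpace (formsRep m) χ)
    (hG : G ∈ highestWeightSpace (formsRep m) χ') :
    F * G ∈ highestWeightSpace (formsRep m) (χ + χ') := fun b hb => by
  rw [formsRep_apply, map_mul, ← formsRep_apply, ← formsRep_apply, hF b hb, hG b hb,
    weightChar_add _ _ hb, smul_mul_smul_comm]

/-- Powers of highest-weight vectors. [folklore] -/
theorem pow_mem_highestWeightSpace_formsRep {χ : Weight (Fin m)} {F : MvPolynomial (Fin m × Fin m) k}
    (hF : F ∈ highestWeightSpace (formsRep m) χ) (n : ℕ) :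
    F ^ n ∈ highestWeightSpace (formsRep m) (n • χ) := by
  induction n with
  | zero =>
    rw [pow_zero, zero_smul]
    intro b hb
    rw [formsRep_apply, map_one, weightChar]
    rw [Finset.prod_eq_one fun i _ => by rw [Pi.zero_apply, zpow_zero], one_smul]
  | succ n ih =>
    rw [pow_succ, succ_nsmul]
    exact mul_mem_highestWeightSpace_formsRep ih hF

/-- Products of highest-weight vectors over a finset. [folklore] -/
theorem prod_mem_highestWeightSpace_formsRep {ι : Type*} (S : Finset ι)
    (f : ι → MvPolynomial (Fin m × Fin m) k) (χ : ι → Weight (Fin m))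
    (h : ∀ i ∈ S, f i ∈ highestWeightSpace (formsRep m) (χ i)) :
    ∏ i ∈ S, f i ∈ highestWeightSpace (formsRep m) (∑ i ∈ S, χ i) := by
  classical
  induction S using Finset.induction_on with
  | empty =>
    rw [Finset.prod_empty, Finset.sum_empty]
    have h1 := pow_mem_highestWeightSpace_formsRep (k := k) (m := m) (χ := 0) (F := 1)
      (fun b hb => by
        rw [formsRep_apply, map_one, weightChar]
        rw [Finset.prod_eq_one fun i _ => by rw [Pi.zero_apply, zpow_zero], one_smul]) 0
    rwa [pow_zero, zero_smul] at h1
  | insert a S ha ih =>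
    rw [Finset.prod_insert ha, Finset.sum_insert ha]
    exact mul_mem_highestWeightSpace_formsRep (h a (Finset.mem_insert_self a S))
      (ih fun i hi => h i (Finset.mem_insert_of_mem hi))

/-- Column permutations preserve highest-weight vectors (they commute with `GL_m`). [folklore] -/
theorem rename_prodMap_mem_highestWeightSpace_formsRep {χ : Weight (Fin m)}
    {F : MvPolynomial (Fin m × Fin m) k} (hF : F ∈ highestWeightSpace (formsRep m) χ)
    (τ : Equiv.Perm (Fin m)) :
    rename (Prod.map id ⇑τ) F ∈ highestWeightSpace (formsRep m) χ := fun b hb => by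
  rw [← rename_prodMap_formsRep, hF b hb, map_smul]

/-- Symmetrisation preserves highest-weight vectors. [folklore] -/
theorem symmetrize_mem_highestWeightSpace_formsRep {χ : Weight (Fin m)}
    {F : MvPolynomial (Fin m × Fin m) k} (hF : F ∈ highestWeightSpace (formsRep m) χ) :
    symmetrize m F ∈ highestWeightSpace (formsRep m) χ :=
  Submodule.sum_mem _ fun τ _ => rename_prodMap_mem_highestWeightSpace_formsRep hF τ

variable (m)

/-! ### Minors on the last rows -/

/-- The `a`-th of the last `r` variable indices: `m - r + a`. [folklore] -/
def lastIdx {r : ℕ} (hr : r ≤ m) (a : Fin r) : Fin m :=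
  ⟨m - r + a, by omega⟩

/-- `lastIdx` is strictly monotone. [folklore] -/
theorem lastIdx_lt_lastIdx_iff {r : ℕ} (hr : r ≤ m) {a a' : Fin r} :
    lastIdx m hr a < lastIdx m hr a' ↔ a < a' := by
  simp only [lastIdx, Fin.lt_def]
  omega

/-- `lastIdx` is injective. [folklore] -/
theorem lastIdx_injective {r : ℕ} (hr : r ≤ m) : Function.Injective (lastIdx m hr) := by
  intro a a' h
  simp only [lastIdx, Fin.mk.injEq] at h
  exact Fin.ext (by omega)

/-- The values of `lastIdx` are the indices `≥ m - r`. [folklore] -/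
theorem le_lastIdx {r : ℕ} (hr : r ≤ m) (a : Fin r) : m - r ≤ (lastIdx m hr a : ℕ) := by
  simp [lastIdx]

/-- An index `≥ m - r` is a `lastIdx`. [folklore] -/
theorem exists_lastIdx_eq {r : ℕ} (hr : r ≤ m) {i : Fin m} (hi : m - r ≤ (i : ℕ)) :
    ∃ a : Fin r, lastIdx m hr a = i :=
  ⟨⟨i - (m - r), by omega⟩, Fin.ext (by simp [lastIdx]; omega)⟩

/-- The matrix of variables on the last `r` rows and the columns `c`. [folklore] -/
def lastMatrix {r : ℕ} (hr : r ≤ m) (c : Fin r → Fin m) :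
    Matrix (Fin r) (Fin r) (MvPolynomial (Fin m × Fin m) k) :=
  Matrix.of fun a b => X (lastIdx m hr a, c b)

/-- **The minor of the generic matrix on the last `r` rows and the forms `c 0, …, c (r-1)`.**
[folklore] -/
def lastMinor {r : ℕ} (hr : r ≤ m) (c : Fin r → Fin m) : MvPolynomial (Fin m × Fin m) k :=
  (lastMatrix (k := k) m hr c).det

/-- The weight `-𝟙_{≥ m-r}` of `GL_m`: the weight of a minor on the last `r` rows. [folklore] -/
def lastWeight (r : ℕ) : Weight (Fin m) :=
  fun i => if m - r ≤ (i : ℕ) then -1 else 0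

/-- The fundamental weight `ω_r = 𝟙_{< r}` (the partition `(1^r)`). [folklore] -/
def fundWeight (r : ℕ) : Weight (Fin m) :=
  fun i => if (i : ℕ) < r then 1 else 0

/-- **The dual of `-𝟙_{≥ m-r}` is the fundamental weight `ω_r`** (`r ≤ m`). [folklore] -/
theorem dual_lastWeight {r : ℕ} (hr : r ≤ m) : (lastWeight m r).dual = fundWeight m r := by
  funext i
  simp only [Weight.dual, lastWeight, fundWeight, Fin.val_rev]
  have hi := i.2
  by_cases h : (i : ℕ) < r
  · rw [if_pos h, if_pos (by omega), neg_neg]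
  · rw [if_neg h, if_neg (by omega), neg_zero]

/-- A column permutation of the variables of a last-rows matrix. [folklore] -/
theorem rename_prodMap_lastMinor {r : ℕ} (hr : r ≤ m) (c : Fin r → Fin m) (τ : Equiv.Perm (Fin m)) :
    rename (Prod.map id ⇑τ) (lastMinor (k := k) m hr c) = lastMinor m hr (⇑τ ∘ c) := by
  rw [lastMinor, lastMinor, AlgHom.map_det]
  congr 1
  ext a b
  simp [lastMatrix, rename_X]

/-- **Evaluating a last-rows minor at a point of `Mat_m`** gives the corresponding minor of the
point. [folklore] -/
theorem eval_lastMinor {r : ℕ} (hr : r ≤ m) (c : Fin r → Fin m) (w : Fin m × Fin m → k) :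
    eval w (lastMinor (k := k) m hr c) = (Matrix.of fun a b : Fin r => w (lastIdx m hr a, c b)).det := by
  rw [lastMinor, RingHom.map_det]
  congr 1
  ext a b
  simp [lastMatrix]

/-- **Minors on the last rows are highest-weight vectors**: for upper triangular `b`,
`b · Δ = (∏_{i ≥ m-r} b_{ii}^{-1}) Δ`, i.e. `Δ ∈ k[Mat_m]^U` of weight `-𝟙_{≥ m-r}` (so of dual weight
`ω_r`): `(b⁻¹ w)` restricted to the last `r` rows is `(b⁻¹)_{≥ m-r, ≥ m-r} · w_{≥ m-r}` because
`b⁻¹` is upper triangular. [cite: BurgisserHuttenhainIkenmeyer2017, §3 (proof of Lemma 5: highest weight vectors of weight (1 × ℓk))] -/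
theorem lastMinor_mem_highestWeightSpace {r : ℕ} (hr : r ≤ m) (c : Fin r → Fin m) :
    lastMinor (k := k) m hr c ∈ highestWeightSpace (formsRep m) (lastWeight m r) := by
  classical
  intro b hb
  have hb' : IsUpperTriangular b⁻¹ := (borelSubgroup (Fin m) k).inv_mem hb
  -- the upper triangular `r × r` block of `b⁻¹` on the last rows, with constant entries
  set Bsub : Matrix (Fin r) (Fin r) (MvPolynomial (Fin m × Fin m) k) :=
    Matrix.of fun a a' => C (((b⁻¹ : GL (Fin m) k) : Matrix (Fin m) (Fin m) k)
      (lastIdx m hr a) (lastIdx m hr a')) with hBsub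
  have hmap : (linSubst (Fin m × Fin m) k
      ((formsBlockGL m b : GL (Fin m × Fin m) k) : Matrix _ _ k)).mapMatrix (lastMatrix (k := k) m hr c) =
      Bsub * lastMatrix m hr c := by
    refine Matrix.ext fun a b' => ?_
    rw [AlgHom.mapMatrix_apply, Matrix.map_apply, Matrix.mul_apply, lastMatrix, Matrix.of_apply,
      ← formsRep_apply, formsRep_X]
    -- restrict the sum over `i` to the last rows
    have hvan : ∀ i ∈ (Finset.univ : Finset (Fin m)), i ∉ Finset.univ.image (lastIdx m hr) →
        ((b⁻¹ : GL (Fin m) k) : Matrix (Fin m) (Fin m) k) (lastIdx m hr a) i •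
          (X (i, c b') : MvPolynomial (Fin m × Fin m) k) = 0 := by
      intro i _ hi
      have hlt : (i : ℕ) < m - r := by
        by_contra hge
        obtain ⟨a', ha'⟩ := exists_lastIdx_eq m hr (not_lt.mp hge)
        exact hi (Finset.mem_image.mpr ⟨a', Finset.mem_univ _, ha'⟩)
      rw [hb'.apply_eq_zero (Fin.lt_def.mpr (lt_of_lt_of_le hlt (le_lastIdx m hr a))), zero_smul]
    rw [← Finset.sum_subset (Finset.subset_univ _) hvan,
      Finset.sum_image (fun a₁ _ a₂ _ h => lastIdx_injective m hr h)]
    refine Finset.sum_congr rfl fun a' _ => ?_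
    simp only [hBsub, Matrix.of_apply, smul_eq_C_mul]
  have hBtri : Bsub.BlockTriangular id := by
    intro a a' hlt
    have hlt' : a' < a := hlt
    simp only [hBsub, Matrix.of_apply]
    rw [hb'.apply_eq_zero ((lastIdx_lt_lastIdx_iff m hr).mpr hlt'), map_zero]
  have hdetB : Bsub.det = C (∏ a : Fin r, ((b⁻¹ : GL (Fin m) k) : Matrix (Fin m) (Fin m) k)
      (lastIdx m hr a) (lastIdx m hr a)) := by
    rw [Matrix.det_of_upperTriangular hBtri, map_prod]
    rfl
  -- the diagonal of `b⁻¹` is the inverse of the diagonal of `b`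
  have hdiag : ∀ i : Fin m, ((b⁻¹ : GL (Fin m) k) : Matrix (Fin m) (Fin m) k) i i =
      (((b : GL (Fin m) k) : Matrix (Fin m) (Fin m) k) i i)⁻¹ := fun i => by
    have h := diag_mul_of_isUpperTriangular hb hb' i
    rw [mul_inv_cancel, Units.val_one, Matrix.one_apply_eq] at h
    exact (eq_inv_of_mul_eq_one_right h.symm)
  have hchar : weightChar (lastWeight m r) b =
      ∏ a : Fin r, ((b⁻¹ : GL (Fin m) k) : Matrix (Fin m) (Fin m) k) (lastIdx m hr a) (lastIdx m hr a) := by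
    rw [weightChar]
    rw [← Finset.prod_subset (Finset.subset_univ (Finset.univ.image (lastIdx m hr))) (fun i _ hi => by
        have hlt : ¬ m - r ≤ (i : ℕ) := fun hge => by
          obtain ⟨a', ha'⟩ := exists_lastIdx_eq m hr hge
          exact hi (Finset.mem_image.mpr ⟨a', Finset.mem_univ _, ha'⟩)
        simp only [lastWeight, if_neg hlt, zpow_zero]),
      Finset.prod_image (fun a₁ _ a₂ _ h => lastIdx_injective m hr h)]
    refine Finset.prod_congr rfl fun a _ => ?_
    simp only [lastWeight, if_pos (le_lastIdx m hr a), zpow_neg, zpow_one, hdiag]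
  rw [formsRep_apply, lastMinor, AlgHom.map_det, hmap, Matrix.det_mul, hdetB, ← lastMinor,
    ← smul_eq_C_mul, hchar]

/-! ### Column degrees -/

/-- The column count of a list of forms: how often each form is used. [folklore] -/
def formCount {r : ℕ} (c : Fin r → Fin m) : Fin m → ℕ :=
  ∑ b : Fin r, Pi.single (c b) 1

/-- Unfolding of `formCount`. [folklore] -/
theorem formCount_apply {r : ℕ} (c : Fin r → Fin m) (j : Fin m) :
    formCount m c j = (Finset.univ.filter fun b : Fin r => c b = j).card := by
  classical
  rw [formCount, Finset.sum_apply, Finset.card_filter]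
  refine Finset.sum_congr rfl fun b _ => ?_
  by_cases h : c b = j
  · rw [h, Pi.single_eq_same, if_pos rfl]
  · rw [Pi.single_eq_of_ne (Ne.symm h), if_neg h]

/-- **A last-rows minor has column degrees its column count.** [folklore] -/
theorem isWeightedHomogeneous_lastMinor {r : ℕ} (hr : r ≤ m) (c : Fin r → Fin m) :
    IsWeightedHomogeneous (colWeight m) (lastMinor (k := k) m hr c) (formCount m c) := by
  classical
  rw [lastMinor, Matrix.det_apply]
  refine IsWeightedHomogeneous.sum _ _ _ fun σ _ => ?_
  rw [Units.smul_def, zsmul_eq_mul, ← map_intCast (C : k →+* MvPolynomial (Fin m × Fin m) k)]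
  refine IsWeightedHomogeneous.C_mul ?_ _
  have h := IsWeightedHomogeneous.prod Finset.univ
    (fun i : Fin r => lastMatrix (k := k) m hr c (σ i) i)
    (fun i => colWeight m (lastIdx m hr (σ i), c i)) (w := colWeight m) fun i _ => by
      rw [lastMatrix, Matrix.of_apply]
      exact isWeightedHomogeneous_X _ _ _
  have hw : (∑ i : Fin r, colWeight m (lastIdx m hr (σ i), c i)) = formCount m c := rfl
  rw [hw] at h
  exact h

end Literature.Computability.AlgebraicComplexity


/-! ## Part II — explicit symmetric highest-weight vectors: BHI's generators realised -/


open MvPolynomial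
open scoped Matrix

namespace Literature.Computability.AlgebraicComplexity

open Literature.NumberTheory.DiophantineGeometry

variable (k : Type*) [Field k] (m : ℕ)

/-! ### Realised weights -/

/-- **`ψ` is realised in degree `δ`**: `𝒪(V^m // H_m)_δ` contains a nonzero highest-weight vector
of weight `ψ` (BHI Lemma 4: the dual weight `ψ^*` lies in `S(V^m // H_m)`, i.e. `V(ψ^*)` occurs in
`Sym^m Sym^δ V`). This is the `formsRep`-model (functions on `Mat_m`) counterpart of the
`coordRep`-model set `symSymOcc` of `Literature/Barriers/ValiantsHypothesis/NotViaSaturationsChowNormal.lean`.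
[cite: BurgisserHuttenhainIkenmeyer2017, Lemma 4] -/
def IsRealized (δ : ℕ) (ψ : Weight (Fin m)) : Prop :=
  ∃ F : MvPolynomial (Fin m × Fin m) k,
    F ≠ 0 ∧ F ∈ symBalanced m δ ∧ F ∈ highestWeightSpace (formsRep m) ψ

variable {k m}

/-- **Realised weights multiply** (products of highest-weight vectors; BHI Lemma 5 is the special
case of multiplication by the powers `v^{⊗ℓk}`). [cite: BurgisserHuttenhainIkenmeyer2017, Lemma 5] -/
theorem IsRealized.mul {δ δ' : ℕ} {ψ ψ' : Weight (Fin m)} (h : IsRealized k m δ ψ)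
    (h' : IsRealized k m δ' ψ') : IsRealized k m (δ + δ') (ψ + ψ') := by
  obtain ⟨F, hF0, hF, hFw⟩ := h
  obtain ⟨G, hG0, hG, hGw⟩ := h'
  exact ⟨F * G, mul_ne_zero hF0 hG0, mul_mem_symBalanced m hF hG,
    mul_mem_highestWeightSpace_formsRep hFw hGw⟩

/-- The trivial weight is realised in degree `0` (by `1`). [folklore] -/
theorem IsRealized.one : IsRealized k m 0 0 := by
  refine ⟨1, one_ne_zero, one_mem_symBalanced m, ?_⟩
  have h := pow_mem_highestWeightSpace_formsRep (k := k) (m := m)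
    (lastMinor_mem_highestWeightSpace (k := k) m (Nat.zero_le m) Fin.elim0) 0
  rwa [pow_zero, zero_smul] at h

/-- Powers of realised weights. [folklore] -/
theorem IsRealized.pow {δ : ℕ} {ψ : Weight (Fin m)} (h : IsRealized k m δ ψ) (n : ℕ) :
    IsRealized k m (n * δ) (n • ψ) := by
  induction n with
  | zero =>
    rw [zero_mul, zero_smul]
    exact IsRealized.one
  | succ n ih =>
    rw [Nat.succ_mul, succ_nsmul]
    exact ih.mul h

/-- Products of realised weights over a finset. [folklore] -/
theorem IsRealized.prod {ι : Type*} (S : Finset ι) (δ : ι → ℕ) (ψ : ι → Weight (Fin m))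
    (h : ∀ i ∈ S, IsRealized k m (δ i) (ψ i)) :
    IsRealized k m (∑ i ∈ S, δ i) (∑ i ∈ S, ψ i) := by
  classical
  induction S using Finset.induction_on with
  | empty =>
    rw [Finset.sum_empty, Finset.sum_empty]
    exact IsRealized.one
  | insert a S ha ih =>
    rw [Finset.sum_insert ha, Finset.sum_insert ha]
    exact (h a (Finset.mem_insert_self a S)).mul (ih fun i hi => h i (Finset.mem_insert_of_mem hi))

/-- **Realisation by a symmetrised product**: if `G` is balanced of degree `δ`, a highest-weight
vector of weight `ψ`, and its symmetrisation `∑_τ τ·G` does not vanish at some point, then `ψ` is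
realised in degree `δ`. [folklore] -/
theorem isRealized_of_eval_symmetrize_ne_zero {δ : ℕ} {ψ : Weight (Fin m)}
    {G : MvPolynomial (Fin m × Fin m) k} (hG : IsBalanced m δ G)
    (hw : G ∈ highestWeightSpace (formsRep m) ψ) (w : Fin m × Fin m → k)
    (h : eval w (symmetrize m G) ≠ 0) : IsRealized k m δ ψ :=
  ⟨symmetrize m G, fun h0 => h (by rw [h0, map_zero]), symmetrize_mem_symBalanced m hG,
    symmetrize_mem_highestWeightSpace_formsRep hw⟩

/-- Evaluating a symmetrisation: `(∑_τ τ·G)(w) = ∑_τ G(w ∘ (id × τ))`. [folklore] -/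
theorem eval_symmetrize (G : MvPolynomial (Fin m × Fin m) k) (w : Fin m × Fin m → k) :
    eval w (symmetrize m G) = ∑ τ : Equiv.Perm (Fin m), eval (w ∘ Prod.map id ⇑τ) G := by
  rw [symmetrize, map_sum]
  exact Finset.sum_congr rfl fun τ _ => eval_rename _ _ _

/-- A sum of products `z_i² n_i` of squares of nonzero integers and positive naturals, cast into a
field of characteristic zero, is nonzero. [folklore] -/
theorem sum_cast_sq_mul_cast_ne_zero [CharZero k] {ι : Type*} [Fintype ι] [Nonempty ι]
    (z : ι → ℤ) (hz : ∀ i, z i ≠ 0) (n : ι → ℕ) (hn : ∀ i, 0 < n i) :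
    (∑ i, ((z i : k)) ^ 2 * (n i : k)) ≠ 0 := by
  have hcast : (∑ i, ((z i : k)) ^ 2 * (n i : k)) = ((∑ i, z i ^ 2 * (n i : ℤ) : ℤ) : k) := by
    push_cast
    rfl
  rw [hcast, Int.cast_ne_zero]
  refine (Finset.sum_pos (fun i _ => ?_) Finset.univ_nonempty).ne'
  exact mul_pos (sq_pos_iff.mpr (hz i)) (Int.natCast_pos.mpr (hn i))

variable (k m)

/-! ### The Vandermonde evaluation point -/

/-- The point of `Mat_m` whose rows `≥ m - K` carry the powers `0, 1, …, K-1` of `t_j = j + 1`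
(other rows zero): the last `K` rows form a transposed Vandermonde matrix. [folklore] -/
def vandPt (K : ℕ) : Fin m × Fin m → k :=
  fun v => if m - K ≤ (v.1 : ℕ) then ((v.2 : ℕ) + 1 : k) ^ ((v.1 : ℕ) - (m - K)) else 0

/-- The Vandermonde point on the last rows. [folklore] -/
theorem vandPt_lastIdx {K : ℕ} (hK : K ≤ m) (a : Fin K) (j : Fin m) :
    vandPt k m K (lastIdx m hK a, j) = ((j : ℕ) + 1 : k) ^ (a : ℕ) := by
  simp only [vandPt, lastIdx, le_add_iff_nonneg_right, Nat.zero_le, if_true, Nat.add_sub_cancel_left]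

/-- **A `K × K` last-rows minor at the (column-permuted) Vandermonde point is a Vandermonde
determinant.** [folklore] -/
theorem eval_vandPt_lastMinor {K : ℕ} (hK : K ≤ m) (c : Fin K → Fin m) (τ : Equiv.Perm (Fin m)) :
    eval (vandPt k m K ∘ Prod.map id ⇑τ) (lastMinor (k := k) m hK c) =
      (Matrix.vandermonde fun b : Fin K => ((τ (c b) : ℕ) + 1 : k)).det := by
  rw [eval_lastMinor]
  have h : (Matrix.of fun a b : Fin K => (vandPt k m K ∘ Prod.map id ⇑τ) (lastIdx m hK a, c b)) =
      (Matrix.vandermonde fun b : Fin K => ((τ (c b) : ℕ) + 1 : k))ᵀ := by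
    ext a b
    simp only [Matrix.of_apply, Function.comp_apply, Prod.map_apply, id_eq, Matrix.transpose_apply,
      Matrix.vandermonde_apply, vandPt_lastIdx]
  rw [h, Matrix.det_transpose]

/-- The integer Vandermonde product `∏_{a<b} (f b - f a)`. [folklore] -/
def vandInt {K : ℕ} (f : Fin K → ℕ) : ℤ :=
  ∏ a : Fin K, ∏ b ∈ Finset.Ioi a, ((f b : ℤ) - (f a : ℤ))

/-- The Vandermonde determinant at the points `f b + 1` is the cast of `vandInt f`. [folklore] -/
theorem det_vandermonde_natCast_succ {K : ℕ} (f : Fin K → ℕ) :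
    (Matrix.vandermonde fun b : Fin K => ((f b : ℕ) + 1 : k)).det = ((vandInt f : ℤ) : k) := by
  rw [Matrix.det_vandermonde, vandInt, Int.cast_prod]
  refine Finset.prod_congr rfl fun a _ => ?_
  rw [Int.cast_prod]
  refine Finset.prod_congr rfl fun b _ => ?_
  push_cast
  ring

/-- `vandInt f ≠ 0` for injective `f`. [folklore] -/
theorem vandInt_ne_zero {K : ℕ} {f : Fin K → ℕ} (hf : Function.Injective f) : vandInt f ≠ 0 := by
  rw [vandInt]
  refine Finset.prod_ne_zero_iff.mpr fun a _ => Finset.prod_ne_zero_iff.mpr fun b hb => ?_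
  rw [sub_ne_zero, Ne, Nat.cast_inj]
  exact fun h => (Finset.mem_Ioi.mp hb).ne' (hf h)

/-! ### The cone generators: `2m · ω_r` realised in degree `2r` -/

/-- The cyclic interval of forms `s, s+1, …, s+r-1` (modulo `m`). [folklore] -/
def cycCols {r : ℕ} (hr : r ≤ m) (s : Fin m) : Fin r → Fin m :=
  fun u => s + Fin.castLE hr u

/-- Cyclic intervals consist of distinct forms. [folklore] -/
theorem cycCols_injective [NeZero m] {r : ℕ} (hr : r ≤ m) (s : Fin m) :
    Function.Injective (cycCols m hr s) := fun _ _ h =>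
  Fin.castLE_injective hr (add_left_cancel h)

/-- **The cone generator** `∏_{s} Δ_r(s, s+1, …, s+r-1)`: the product of the last-rows minors on all
cyclic intervals of forms (each form lies in exactly `r` intervals). [folklore] -/
def coneGen {r : ℕ} (hr : r ≤ m) : MvPolynomial (Fin m × Fin m) k :=
  ∏ s : Fin m, lastMinor m hr (cycCols m hr s)

/-- The cone generator is a highest-weight vector of weight `m · (-𝟙_{≥ m-r})`. [folklore] -/
theorem coneGen_mem_highestWeightSpace {r : ℕ} (hr : r ≤ m) :
    coneGen k m hr ∈ highestWeightSpace (formsRep m) (m • lastWeight m r) := by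
  have h := prod_mem_highestWeightSpace_formsRep Finset.univ
    (fun s => lastMinor (k := k) m hr (cycCols m hr s)) (fun _ => lastWeight m r)
    fun s _ => lastMinor_mem_highestWeightSpace m hr _
  rwa [Finset.sum_const, Finset.card_univ, Fintype.card_fin] at h

/-- The cone generator is balanced of degree `r`. [folklore] -/
theorem isBalanced_coneGen [NeZero m] {r : ℕ} (hr : r ≤ m) : IsBalanced m r (coneGen k m hr) := by
  classical
  have h := IsWeightedHomogeneous.prod Finset.univ
    (fun s => lastMinor (k := k) m hr (cycCols m hr s)) (fun s => formCount m (cycCols m hr s))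
    (w := colWeight m) fun s _ => isWeightedHomogeneous_lastMinor m hr _
  have hsum : (∑ s : Fin m, formCount m (cycCols m hr s)) = fun _ => r := by
    funext j
    rw [Finset.sum_apply]
    simp only [formCount, Finset.sum_apply]
    rw [Finset.sum_comm]
    have hone : ∀ u : Fin r, ∑ s : Fin m, (Pi.single (cycCols m hr s u) 1 : Fin m → ℕ) j = 1 := by
      intro u
      rw [Finset.sum_eq_single (j - Fin.castLE hr u)]
      · rw [cycCols, sub_add_cancel, Pi.single_eq_same]
      · intro s _ hs
        rw [Pi.single_eq_of_ne]
        intro h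
        apply hs
        rw [h, cycCols, add_sub_cancel_right]
      · intro h
        exact absurd (Finset.mem_univ _) h
    simp_rw [hone]
    simp
  rw [coneGen, IsBalanced, ← hsum]
  exact h

/-- The cone generator at the Vandermonde point: a product of integer Vandermonde products.
[folklore] -/
theorem eval_vandPt_coneGen {r : ℕ} (hr : r ≤ m) (τ : Equiv.Perm (Fin m)) :
    eval (vandPt k m r ∘ Prod.map id ⇑τ) (coneGen k m hr) =
      ((∏ s : Fin m, vandInt (fun b => (τ (cycCols m hr s b) : ℕ)) : ℤ) : k) := by
  rw [coneGen, map_prod, Int.cast_prod]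
  refine Finset.prod_congr rfl fun s _ => ?_
  rw [eval_vandPt_lastMinor, det_vandermonde_natCast_succ]

/-- **`2m · (-𝟙_{≥ m-r})` (dual weight `2m ω_r`) is realised in degree `2r`** (`1 ≤ m`, `r ≤ m`), by
the symmetrisation of the square of the cone generator, which is nonzero at the Vandermonde point:
a sum over `τ ∈ S_m` of squares of nonzero integers. [cite: BurgisserHuttenhainIkenmeyer2017, §3 (proof of Prop. 2: the rational cone)] -/
theorem isRealized_coneGen [CharZero k] [NeZero m] {r : ℕ} (hr : r ≤ m) :
    IsRealized k m (r + r) (2 • (m • lastWeight m r)) := by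
  classical
  have hbal : IsBalanced m (r + r) (coneGen k m hr * coneGen k m hr) :=
    (isBalanced_coneGen k m hr).mul (isBalanced_coneGen k m hr)
  have hw : coneGen k m hr * coneGen k m hr ∈
      highestWeightSpace (formsRep m) (2 • (m • lastWeight m r)) := by
    rw [two_smul]
    exact mul_mem_highestWeightSpace_formsRep (coneGen_mem_highestWeightSpace k m hr)
      (coneGen_mem_highestWeightSpace k m hr)
  refine isRealized_of_eval_symmetrize_ne_zero hbal hw (vandPt k m r) ?_
  rw [eval_symmetrize]
  simp_rw [map_mul, eval_vandPt_coneGen]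
  have h := sum_cast_sq_mul_cast_ne_zero (k := k)
    (fun τ : Equiv.Perm (Fin m) => ∏ s : Fin m, vandInt (fun b => (τ (cycCols m hr s b) : ℕ)))
    (fun τ => Finset.prod_ne_zero_iff.mpr fun s _ => vandInt_ne_zero
      (Fin.val_injective.comp (τ.injective.comp (cycCols_injective m hr s))))
    (fun _ => 1) (fun _ => Nat.one_pos)
  simpa [sq] using h

/-! ### Values of the Vandermonde point on the last two rows and the last row -/

/-- The Vandermonde point at a row `≥ m - K`. [folklore] -/
theorem vandPt_apply_of_le {K : ℕ} {i : Fin m} (hi : m - K ≤ (i : ℕ)) (j : Fin m) :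
    vandPt k m K (i, j) = ((j : ℕ) + 1 : k) ^ ((i : ℕ) - (m - K)) := by
  simp only [vandPt, if_pos hi]

/-- The entry `x_j` of the last row in column `j`, as a `1 × 1` last-rows minor. [folklore] -/
def lastX (h1 : 1 ≤ m) (j : Fin m) : MvPolynomial (Fin m × Fin m) k :=
  lastMinor m h1 (fun _ : Fin 1 => j)

/-- The `2 × 2` minor `Δ_2(a, b)` on the last two rows and the forms `a, b`. [folklore] -/
def minor2 (h2 : 2 ≤ m) (a b : Fin m) : MvPolynomial (Fin m × Fin m) k :=
  lastMinor m h2 ![a, b]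

/-- `x_j` at the permuted Vandermonde point: `(τ j + 1)^{K-1}`. [folklore] -/
theorem eval_vandPt_lastX {K : ℕ} (h1 : 1 ≤ K) (hK : K ≤ m) (j : Fin m) (τ : Equiv.Perm (Fin m)) :
    eval (vandPt k m K ∘ Prod.map id ⇑τ) (lastX k m (le_trans h1 hK) j) =
      ((((τ j : ℕ) + 1) ^ (K - 1) : ℕ) : k) := by
  rw [lastX, eval_lastMinor, Matrix.det_unique]
  simp only [Matrix.of_apply, Function.comp_apply, Prod.map_apply, id_eq]
  rw [vandPt_apply_of_le k m (by simp [lastIdx]; omega)]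
  simp only [lastIdx, Fin.default_eq_zero, Fin.val_zero, add_zero]
  push_cast
  congr 1
  omega

/-- `Δ_2(a,b)` at the permuted Vandermonde point: `(t_b - t_a)(t_a t_b)^{K-2}` with `t_j = τ j + 1`.
[folklore] -/
theorem eval_vandPt_minor2 {K : ℕ} (h2 : 2 ≤ K) (hK : K ≤ m) (a b : Fin m) (τ : Equiv.Perm (Fin m)) :
    eval (vandPt k m K ∘ Prod.map id ⇑τ) (minor2 k m (le_trans h2 hK) a b) =
      ((((τ b : ℕ) : ℤ) - ((τ a : ℕ) : ℤ) : ℤ) : k) *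
        ((((τ a : ℕ) + 1) ^ (K - 2) * ((τ b : ℕ) + 1) ^ (K - 2) : ℕ) : k) := by
  rw [minor2, eval_lastMinor, Matrix.det_fin_two]
  simp only [Matrix.of_apply, Function.comp_apply, Prod.map_apply, id_eq, Matrix.cons_val_zero,
    Matrix.cons_val_one]
  have h0 : ((lastIdx m (le_trans h2 hK) (0 : Fin 2) : Fin m) : ℕ) = m - 2 := by simp [lastIdx]
  have h1 : ((lastIdx m (le_trans h2 hK) (1 : Fin 2) : Fin m) : ℕ) = m - 1 := by
    simp [lastIdx]; omega
  rw [vandPt_apply_of_le k m (by omega), vandPt_apply_of_le k m (by omega),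
    vandPt_apply_of_le k m (by omega), vandPt_apply_of_le k m (by omega), h0, h1]
  have he1 : m - 2 - (m - K) = K - 2 := by omega
  have he2 : m - 1 - (m - K) = (K - 2) + 1 := by omega
  rw [he1, he2]
  push_cast
  ring

/-! ### BHI's `λ^{(k)}` (Lemma 6; for `k = 2` the partition `(2m-2,2)`): the generator `genK` -/

/-- **The generator for `λ^{(K)}`**: `Δ_K(0,…,K-1) · ∏_{a<b<K} Δ_2(a,b) · ∏_{j ≥ K} x_j^K`
(`2 ≤ K ≤ m`). Each of the forms `0,…,K-1` is used once in the big minor and `K-1` times in the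
`2 × 2` minors; the other forms `K` times in the last row. [cite: BurgisserHuttenhainIkenmeyer2017, Lemma 6] -/
def genK {K : ℕ} (h2 : 2 ≤ K) (hK : K ≤ m) : MvPolynomial (Fin m × Fin m) k :=
  lastMinor m hK (Fin.castLE hK) *
    (∏ a : Fin K, ∏ b ∈ Finset.Ioi a,
      minor2 k m (le_trans h2 hK) (Fin.castLE hK a) (Fin.castLE hK b)) *
    ∏ j ∈ Finset.univ.filter (fun j : Fin m => K ≤ (j : ℕ)),
      lastX k m (le_trans (le_trans one_le_two h2) hK) j ^ K

/-- The weight of `genK`: `-𝟙_{≥ m-K} + C(K,2)·(-𝟙_{≥ m-2}) + (m-K)K·(-𝟙_{m-1})`.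
[cite: BurgisserHuttenhainIkenmeyer2017, Lemma 6] -/
def psiK (K : ℕ) : Weight (Fin m) :=
  lastWeight m K + (∑ a : Fin K, ∑ _b ∈ Finset.Ioi a, lastWeight m 2) +
    ∑ _j ∈ Finset.univ.filter (fun j : Fin m => K ≤ (j : ℕ)), K • lastWeight m 1

/-- `genK` is a highest-weight vector of weight `psiK`. [cite: BurgisserHuttenhainIkenmeyer2017, Lemma 6] -/
theorem genK_mem_highestWeightSpace {K : ℕ} (h2 : 2 ≤ K) (hK : K ≤ m) :
    genK k m h2 hK ∈ highestWeightSpace (formsRep m) (psiK m K) := by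
  refine mul_mem_highestWeightSpace_formsRep (mul_mem_highestWeightSpace_formsRep
    (lastMinor_mem_highestWeightSpace m hK _)
    (prod_mem_highestWeightSpace_formsRep _ _ _ fun a _ =>
      prod_mem_highestWeightSpace_formsRep _ _ _ fun b _ => lastMinor_mem_highestWeightSpace m _ _))
    (prod_mem_highestWeightSpace_formsRep _ _ _ fun j _ =>
      pow_mem_highestWeightSpace_formsRep (lastMinor_mem_highestWeightSpace m _ _) K)

/-- Column count of a single form. [folklore] -/
theorem formCount_const_one (j : Fin m) : formCount m (fun _ : Fin 1 => j) = Pi.single j 1 := by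
  rw [formCount, Fin.sum_univ_one]

/-- Column count of a pair of forms. [folklore] -/
theorem formCount_pair (a b : Fin m) : formCount m ![a, b] = Pi.single a 1 + Pi.single b 1 := by
  rw [formCount, Fin.sum_univ_two]
  rfl

/-- Column count of the first `K` forms. [folklore] -/
theorem formCount_castLE_apply {K : ℕ} (hK : K ≤ m) (j : Fin m) :
    formCount m (Fin.castLE hK) j = if (j : ℕ) < K then 1 else 0 := by
  classical
  rw [formCount_apply]
  by_cases hj : (j : ℕ) < K
  · rw [if_pos hj, Finset.card_eq_one]
    refine ⟨⟨j, hj⟩, ?_⟩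
    ext b
    simp only [Finset.mem_filter, Finset.mem_univ, true_and, Finset.mem_singleton]
    constructor
    · intro h
      apply Fin.ext
      change (b : ℕ) = (j : ℕ)
      rw [← h, Fin.val_castLE]
    · intro h
      rw [h]
      exact Fin.ext rfl
  · rw [if_neg hj, Finset.card_eq_zero, Finset.filter_eq_empty_iff]
    intro b _ h
    apply hj
    rw [← h]
    exact b.2

/-- The double sum over pairs `a < b` of `f a + f b` counts every index `K - 1` times. [folklore] -/
theorem sum_sum_Ioi_add {M : Type*} [AddCommMonoid M] {K : ℕ} (f : Fin K → M) :
    (∑ a : Fin K, ∑ b ∈ Finset.Ioi a, (f a + f b)) = (K - 1) • ∑ a : Fin K, f a := by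
  simp_rw [Finset.sum_add_distrib]
  have h1 : (∑ a : Fin K, ∑ _b ∈ Finset.Ioi a, f a) = ∑ a : Fin K, (Finset.Ioi a).card • f a :=
    Finset.sum_congr rfl fun a _ => Finset.sum_const _
  have h2 : (∑ a : Fin K, ∑ b ∈ Finset.Ioi a, f b) = ∑ b : Fin K, (Finset.Iio b).card • f b := by
    rw [Finset.sum_comm' (fun a b => show a ∈ (Finset.univ : Finset (Fin K)) ∧ b ∈ Finset.Ioi a ↔
        a ∈ Finset.Iio b ∧ b ∈ (Finset.univ : Finset (Fin K)) from by
      simp only [Finset.mem_Iio, Finset.mem_univ, and_true, true_and, Finset.mem_Ioi])]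
    exact Finset.sum_congr rfl fun b _ => Finset.sum_const _
  rw [h1, h2, ← Finset.sum_add_distrib, Finset.smul_sum]
  refine Finset.sum_congr rfl fun a _ => ?_
  rw [← add_smul, Fin.card_Ioi, Fin.card_Iio]
  congr 1
  have := a.2
  omega

/-- `genK` is balanced of degree `K`. [cite: BurgisserHuttenhainIkenmeyer2017, Lemma 6] -/
theorem isBalanced_genK {K : ℕ} (h2 : 2 ≤ K) (hK : K ≤ m) : IsBalanced m K (genK k m h2 hK) := by
  classical
  have hA := isWeightedHomogeneous_lastMinor (k := k) m hK (Fin.castLE hK)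
  have hB := IsWeightedHomogeneous.prod Finset.univ
    (fun a : Fin K => ∏ b ∈ Finset.Ioi a,
      minor2 k m (le_trans h2 hK) (Fin.castLE hK a) (Fin.castLE hK b))
    (fun a => ∑ b ∈ Finset.Ioi a, (Pi.single (Fin.castLE hK a) 1 + Pi.single (Fin.castLE hK b) 1))
    (w := colWeight m) fun a _ => IsWeightedHomogeneous.prod (Finset.Ioi a) _ _ fun b _ => by
      have h := isWeightedHomogeneous_lastMinor (k := k) m (le_trans h2 hK)
        ![Fin.castLE hK a, Fin.castLE hK b]
      rwa [formCount_pair] at h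
  have hC := IsWeightedHomogeneous.prod (Finset.univ.filter (fun j : Fin m => K ≤ (j : ℕ)))
    (fun j => lastX k m (le_trans (le_trans one_le_two h2) hK) j ^ K)
    (fun j => K • Pi.single j 1) (w := colWeight m) fun j _ => by
      have h := (isWeightedHomogeneous_lastMinor (k := k) m (le_trans (le_trans one_le_two h2) hK)
        (fun _ : Fin 1 => j)).pow K
      rwa [formCount_const_one] at h
  have h := (hA.mul hB).mul hC
  rw [sum_sum_Ioi_add] at h
  refine (congrArg (IsWeightedHomogeneous (colWeight m) (genK k m h2 hK)) ?_).mp h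
  funext j
  simp only [Pi.add_apply, Pi.smul_apply, Finset.sum_apply, smul_eq_mul]
  rw [show (∑ a : Fin K, (Pi.single (Fin.castLE hK a) (1 : ℕ) : Fin m → ℕ) j) =
      formCount m (Fin.castLE hK) j by rw [formCount, Finset.sum_apply], formCount_castLE_apply]
  by_cases hj : (j : ℕ) < K
  · rw [if_pos hj, Finset.sum_eq_zero (fun j' hj' => ?_)]
    · omega
    · rw [Finset.mem_filter] at hj'
      rw [Pi.single_eq_of_ne (fun h => ?_), mul_zero]
      rw [h] at hj
      omega
  · rw [if_neg hj, Finset.sum_eq_single_of_mem j (Finset.mem_filter.mpr ⟨Finset.mem_univ _, by omega⟩)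
      (fun j' _ hj' => by rw [Pi.single_eq_of_ne (Ne.symm hj'), mul_zero]), Pi.single_eq_same]
    omega

/-- The positive natural number factor of `genK` at the Vandermonde point. [folklore] -/
def genKNat {K : ℕ} (hK : K ≤ m) (τ : Equiv.Perm (Fin m)) : ℕ :=
  (∏ a : Fin K, ∏ b ∈ Finset.Ioi a,
      ((τ (Fin.castLE hK a) : ℕ) + 1) ^ (K - 2) * ((τ (Fin.castLE hK b) : ℕ) + 1) ^ (K - 2)) *
    ∏ j ∈ Finset.univ.filter (fun j : Fin m => K ≤ (j : ℕ)), (((τ j : ℕ) + 1) ^ (K - 1)) ^ K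

/-- The natural number factor is positive. [folklore] -/
theorem genKNat_pos {K : ℕ} (hK : K ≤ m) (τ : Equiv.Perm (Fin m)) : 0 < genKNat m hK τ := by
  refine mul_pos (Finset.prod_pos fun a _ => Finset.prod_pos fun b _ => ?_)
    (Finset.prod_pos fun j _ => ?_) <;> positivity

/-- **`genK` at the Vandermonde point is a square times a positive integer**:
`V(t)² · ∏ (t_a t_b)^{K-2} · ∏ t_j^{K(K-1)}` with `V(t)` the Vandermonde product of the first `K`
(permuted) points. [folklore] -/
theorem eval_vandPt_genK {K : ℕ} (h2 : 2 ≤ K) (hK : K ≤ m) (τ : Equiv.Perm (Fin m)) :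
    eval (vandPt k m K ∘ Prod.map id ⇑τ) (genK k m h2 hK) =
      ((vandInt (fun b : Fin K => (τ (Fin.castLE hK b) : ℕ)) : ℤ) : k) ^ 2 *
        ((genKNat m hK τ : ℕ) : k) := by
  rw [genK, map_mul, map_mul, eval_vandPt_lastMinor, det_vandermonde_natCast_succ, map_prod, map_prod]
  simp_rw [map_prod, map_pow, eval_vandPt_minor2 k m h2 hK,
    eval_vandPt_lastX k m (le_trans one_le_two h2) hK, Finset.prod_mul_distrib]
  rw [genKNat, vandInt]
  push_cast
  ring

/-- **The weight `psiK` is realised in degree `K`** (`2 ≤ K ≤ m`): the symmetrisation of `genK` is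
nonzero at the Vandermonde point (a sum of positive integers). For the dual weights: BHI Lemma 6
(`λ^{(k)}` occurs in `Sym^n Sym^k V`) and, for `K = 2`, "`(2n-2,2,0,…,0)` occurs in `Sym^nSym^2V`".
[cite: BurgisserHuttenhainIkenmeyer2017, Lemma 6 and Prop. 3 (proof)] -/
theorem isRealized_genK [CharZero k] {K : ℕ} (h2 : 2 ≤ K) (hK : K ≤ m) :
    IsRealized k m K (psiK m K) := by
  classical
  haveI : Nonempty (Equiv.Perm (Fin m)) := ⟨1⟩
  refine isRealized_of_eval_symmetrize_ne_zero (isBalanced_genK k m h2 hK)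
    (genK_mem_highestWeightSpace k m h2 hK) (vandPt k m K) ?_
  rw [eval_symmetrize]
  simp_rw [eval_vandPt_genK]
  exact sum_cast_sq_mul_cast_ne_zero _
    (fun τ => vandInt_ne_zero (Fin.val_injective.comp (τ.injective.comp (Fin.castLE_injective hK))))
    _ (fun τ => genKNat_pos m hK τ)

/-! ### The partition `(3m-3, 3)`: the generator `gen3` -/

/-- The exponents of the last-row factors of `gen3`: `x_1, x_2², x_j³ (j ≥ 3)`. [folklore] -/
def e3 (j : Fin m) : ℕ :=
  if (j : ℕ) = 1 then 1 else if (j : ℕ) = 2 then 2 else 3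

/-- The exponents are positive. [folklore] -/
theorem e3_ne_zero (j : Fin m) : e3 m j ≠ 0 := by
  unfold e3
  split_ifs <;> decide

/-- **The generator for `(3m-3, 3)`** (`m ≥ 3`): `Δ_2(0,1)² · Δ_2(0,2) · x_1 · x_2² · ∏_{j≥3} x_j³`
(every form used three times). [cite: BurgisserHuttenhainIkenmeyer2017, Prop. 3 (proof: (3n-3,3,0,…,0) occurs in Sym^nSym^3V)] -/
def gen3 (h3 : 3 ≤ m) : MvPolynomial (Fin m × Fin m) k :=
  minor2 k m (by omega) ⟨0, by omega⟩ ⟨1, by omega⟩ ^ 2 *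
      minor2 k m (by omega) ⟨0, by omega⟩ ⟨2, by omega⟩ *
    ∏ j ∈ Finset.univ.filter (fun j : Fin m => (j : ℕ) ≠ 0), lastX k m (by omega) j ^ e3 m j

/-- The weight of `gen3`: `2·(-𝟙_{≥m-2}) + (-𝟙_{≥m-2}) + ∑_{j ≠ 0} e3(j)·(-𝟙_{m-1})`
(dual weight `3 ω_2 + (3m-6) ω_1 = (3m-3, 3)`). [cite: BurgisserHuttenhainIkenmeyer2017, Prop. 3 (proof)] -/
def psi3 : Weight (Fin m) :=
  2 • lastWeight m 2 + lastWeight m 2 +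
    ∑ j ∈ Finset.univ.filter (fun j : Fin m => (j : ℕ) ≠ 0), e3 m j • lastWeight m 1

/-- `gen3` is a highest-weight vector of weight `psi3`. [cite: BurgisserHuttenhainIkenmeyer2017, Prop. 3 (proof)] -/
theorem gen3_mem_highestWeightSpace (h3 : 3 ≤ m) :
    gen3 k m h3 ∈ highestWeightSpace (formsRep m) (psi3 m) :=
  mul_mem_highestWeightSpace_formsRep (mul_mem_highestWeightSpace_formsRep
    (pow_mem_highestWeightSpace_formsRep (lastMinor_mem_highestWeightSpace m _ _) 2)
    (lastMinor_mem_highestWeightSpace m _ _))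
    (prod_mem_highestWeightSpace_formsRep _ _ _ fun _ _ =>
      pow_mem_highestWeightSpace_formsRep (lastMinor_mem_highestWeightSpace m _ _) _)

/-- `gen3` is balanced of degree `3`. [cite: BurgisserHuttenhainIkenmeyer2017, Prop. 3 (proof)] -/
theorem isBalanced_gen3 (h3 : 3 ≤ m) : IsBalanced m 3 (gen3 k m h3) := by
  classical
  have hA := ((isWeightedHomogeneous_lastMinor (k := k) m (r := 2) (by omega)
    ![(⟨0, by omega⟩ : Fin m), ⟨1, by omega⟩]).pow 2).mul
    (isWeightedHomogeneous_lastMinor (k := k) m (r := 2) (by omega)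
      ![(⟨0, by omega⟩ : Fin m), ⟨2, by omega⟩])
  rw [formCount_pair, formCount_pair] at hA
  have hC := IsWeightedHomogeneous.prod (Finset.univ.filter (fun j : Fin m => (j : ℕ) ≠ 0))
    (fun j => lastX k m (by omega) j ^ e3 m j) (fun j => e3 m j • Pi.single j 1)
    (w := colWeight m) fun j _ => by
      have h := (isWeightedHomogeneous_lastMinor (k := k) m (r := 1) (by omega)
        (fun _ : Fin 1 => j)).pow (e3 m j)
      rwa [formCount_const_one] at h
  have h := hA.mul hC
  refine (congrArg (IsWeightedHomogeneous (colWeight m) (gen3 k m h3)) ?_).mp h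
  funext j
  simp only [Pi.add_apply, Pi.smul_apply, Finset.sum_apply, smul_eq_mul, Pi.single_apply,
    Fin.ext_iff]
  have hsum : (∑ x ∈ Finset.univ.filter (fun j : Fin m => (j : ℕ) ≠ 0),
      e3 m x * (if (j : ℕ) = (x : ℕ) then 1 else 0)) = if (j : ℕ) = 0 then 0 else e3 m j := by
    by_cases hj : (j : ℕ) = 0
    · rw [if_pos hj]
      refine Finset.sum_eq_zero fun x hx => ?_
      rw [Finset.mem_filter] at hx
      rw [if_neg (fun h : (j : ℕ) = (x : ℕ) => hx.2 (h ▸ hj)), mul_zero]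
    · rw [if_neg hj, Finset.sum_eq_single_of_mem j (Finset.mem_filter.mpr ⟨Finset.mem_univ _, hj⟩)
        (fun x _ hx => by rw [if_neg (fun h => hx (Fin.ext h.symm)), mul_zero]), if_pos rfl, mul_one]
  rw [hsum]
  unfold e3
  have := j.2
  split_ifs <;> omega

/-- The `0/1`-point certifying `gen3`: last row `x_j = [j ≠ 0]`, row `m-2`: `y_j = [j = 0]`, other rows
zero. [folklore] -/
def zoPt : Fin m × Fin m → k :=
  fun v => if (v.1 : ℕ) = m - 1 then (if (v.2 : ℕ) = 0 then 0 else 1)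
    else if (v.1 : ℕ) = m - 2 then (if (v.2 : ℕ) = 0 then 1 else 0) else 0

/-- `x_j` at the permuted `0/1`-point. [folklore] -/
theorem eval_zoPt_lastX (h1 : 1 ≤ m) (j : Fin m) (τ : Equiv.Perm (Fin m)) :
    eval (zoPt k m ∘ Prod.map id ⇑τ) (lastX k m h1 j) = if ((τ j : Fin m) : ℕ) = 0 then 0 else 1 := by
  rw [lastX, eval_lastMinor, Matrix.det_unique]
  simp only [Matrix.of_apply, Function.comp_apply, Prod.map_apply, id_eq, zoPt]
  have h : ((lastIdx m h1 (default : Fin 1) : Fin m) : ℕ) = m - 1 := by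
    simp [lastIdx, Fin.default_eq_zero]
  rw [if_pos h]
  split_ifs <;> rfl

/-- `Δ_2(a,b)` at the permuted `0/1`-point. [folklore] -/
theorem eval_zoPt_minor2 (h2 : 2 ≤ m) (a b : Fin m) (τ : Equiv.Perm (Fin m)) :
    eval (zoPt k m ∘ Prod.map id ⇑τ) (minor2 k m h2 a b) =
      (if ((τ a : Fin m) : ℕ) = 0 then (1 : k) else 0) * (if ((τ b : Fin m) : ℕ) = 0 then 0 else 1) -
        (if ((τ b : Fin m) : ℕ) = 0 then (1 : k) else 0) * (if ((τ a : Fin m) : ℕ) = 0 then 0 else 1) := by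
  rw [minor2, eval_lastMinor, Matrix.det_fin_two]
  simp only [Matrix.of_apply, Function.comp_apply, Prod.map_apply, id_eq, Matrix.cons_val_zero,
    Matrix.cons_val_one, zoPt]
  have h0 : ((lastIdx m h2 (0 : Fin 2) : Fin m) : ℕ) = m - 2 := by simp [lastIdx]
  have h1 : ((lastIdx m h2 (1 : Fin 2) : Fin m) : ℕ) = m - 1 := by
    simp [lastIdx]; omega
  have hne : (m - 2 : ℕ) ≠ m - 1 := by omega
  have hne' : (m - 1 : ℕ) ≠ m - 2 := by omega
  simp only [h0, h1, hne, hne', if_true, if_false]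
  split_ifs <;> norm_num

/-- **`gen3` at the permuted `0/1`-point is `1` if `τ` fixes the form `0`, and `0` otherwise.**
[folklore] -/
theorem eval_zoPt_gen3 (h3 : 3 ≤ m) (τ : Equiv.Perm (Fin m)) :
    eval (zoPt k m ∘ Prod.map id ⇑τ) (gen3 k m h3) =
      if τ ⟨0, by omega⟩ = ⟨0, by omega⟩ then 1 else 0 := by
  classical
  rw [gen3, map_mul, map_mul, map_pow, map_prod]
  simp_rw [map_pow, eval_zoPt_minor2, eval_zoPt_lastX]
  by_cases hτ : τ ⟨0, by omega⟩ = ⟨0, by omega⟩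
  · rw [if_pos hτ]
    have hne : ∀ j : Fin m, (j : ℕ) ≠ 0 → ((τ j : Fin m) : ℕ) ≠ 0 := fun j hj h => by
      apply hj
      have : τ j = τ ⟨0, by omega⟩ := by rw [hτ]; exact Fin.ext h
      exact congrArg Fin.val (τ.injective this)
    have h0 : ((τ ⟨0, by omega⟩ : Fin m) : ℕ) = 0 := by rw [hτ]
    rw [if_pos h0, if_neg (hne ⟨1, by omega⟩ (by norm_num)), if_neg (hne ⟨1, by omega⟩ (by norm_num)),
      if_neg (hne ⟨2, by omega⟩ (by norm_num)), if_neg (hne ⟨2, by omega⟩ (by norm_num))]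
    rw [Finset.prod_eq_one (fun j hj => by
      rw [Finset.mem_filter] at hj
      rw [if_neg (hne j hj.2), one_pow])]
    norm_num
  · rw [if_neg hτ]
    set j₀ : Fin m := τ.symm ⟨0, by omega⟩ with hj₀
    have hj₀ne : (j₀ : ℕ) ≠ 0 := fun h => by
      apply hτ
      have hj : j₀ = ⟨0, by omega⟩ := Fin.ext h
      have h' : τ j₀ = ⟨0, by omega⟩ := by rw [hj₀, Equiv.apply_symm_apply]
      rwa [hj] at h'
    have hzero : (if ((τ j₀ : Fin m) : ℕ) = 0 then (0 : k) else 1) ^ e3 m j₀ = 0 := by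
      rw [hj₀, Equiv.apply_symm_apply, if_pos rfl, zero_pow (e3_ne_zero m _)]
    rw [Finset.prod_eq_zero (Finset.mem_filter.mpr ⟨Finset.mem_univ j₀, hj₀ne⟩) hzero, mul_zero]

/-- **The weight `psi3` (dual weight `(3m-3, 3)`) is realised in degree `3`** (`m ≥ 3`): the
symmetrisation of `gen3` takes the value `#{τ | τ 0 = 0} ≠ 0` at the `0/1`-point. In print:
"`(6,3,0,…,0)` occurs in `Sym^3Sym^3V`" (Schur program) and Lemma 5.
[cite: BurgisserHuttenhainIkenmeyer2017, Prop. 3 (proof)] -/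
theorem isRealized_gen3 [CharZero k] (h3 : 3 ≤ m) : IsRealized k m 3 (psi3 m) := by
  classical
  refine isRealized_of_eval_symmetrize_ne_zero (isBalanced_gen3 k m h3)
    (gen3_mem_highestWeightSpace k m h3) (zoPt k m) ?_
  rw [eval_symmetrize]
  simp_rw [eval_zoPt_gen3]
  rw [Finset.sum_boole, Nat.cast_ne_zero, ← Nat.pos_iff_ne_zero, Finset.card_pos]
  exact ⟨1, Finset.mem_filter.mpr ⟨Finset.mem_univ _, rfl⟩⟩

/-! ### Dual coordinates of the realised weights -/

/-- The dual of a sum of weights (private copy of `Weight.dual_add` of the Barriers layer, which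
this file cannot import). [folklore] -/
private theorem wdual_add (χ ψ : Weight (Fin m)) : (χ + ψ).dual = χ.dual + ψ.dual := by
  funext i
  simp [Weight.dual, add_comm]

/-- The dual of the zero weight (private copy of `Weight.dual_zero`). [folklore] -/
private theorem wdual_zero : (0 : Weight (Fin m)).dual = 0 := by
  funext i
  simp [Weight.dual]

/-- The dual of a multiple of a weight (private copy of `Weight.dual_nsmul`). [folklore] -/
private theorem wdual_nsmul (n : ℕ) (χ : Weight (Fin m)) : (n • χ).dual = n • χ.dual := by
  funext i
  simp [Weight.dual]

/-- Duals of finset sums of weights. [folklore] -/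
private theorem weightDual_sum {ι : Type*} (S : Finset ι) (χ : ι → Weight (Fin m)) :
    (∑ i ∈ S, χ i).dual = ∑ i ∈ S, (χ i).dual := by
  classical
  induction S using Finset.induction_on with
  | empty => rw [Finset.sum_empty, Finset.sum_empty, wdual_zero]
  | insert a S ha ih => rw [Finset.sum_insert ha, Finset.sum_insert ha, wdual_add, ih]

/-- The fundamental weight `ω_r` at an index. [folklore] -/
theorem fundWeight_apply (r : ℕ) (i : Fin m) : fundWeight m r i = if (i : ℕ) < r then 1 else 0 :=
  rfl

/-- **The dual coordinates of `psiK` beyond the second row**: `(psiK K)^*_i = [i < K]` for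
`2 ≤ i` — so `λ^{(K)}_{K-1} = 1` (0-based) and `λ^{(K)}_i = 0` for `i ≥ K` ("we have
`λ^{(k)}_k = 1` and `λ^{(k)}_i = 0` for `i > k`", 1-based). [cite: BurgisserHuttenhainIkenmeyer2017, Prop. 3 (proof)] -/
theorem dual_psiK_apply_of_two_le {K : ℕ} (hK : K ≤ m) (i : Fin m) (hi : 2 ≤ (i : ℕ)) :
    (psiK m K).dual i = if (i : ℕ) < K then 1 else 0 := by
  have h2 : 2 ≤ m := le_trans hi (le_of_lt i.2)
  have h1 : 1 ≤ m := le_trans one_le_two h2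
  rw [psiK, wdual_add, wdual_add, weightDual_sum, weightDual_sum, dual_lastWeight m hK]
  simp only [Pi.add_apply, Finset.sum_apply, weightDual_sum, wdual_nsmul, Pi.smul_apply,
    dual_lastWeight m h2, dual_lastWeight m h1, fundWeight_apply]
  rw [if_neg (show ¬ (i : ℕ) < 2 by omega), if_neg (show ¬ (i : ℕ) < 1 by omega)]
  simp

/-- **The dual coordinates of `psiK 2` (the partition `(2m-2, 2)`)**: second coordinate `2`, none
beyond. [cite: BurgisserHuttenhainIkenmeyer2017, Prop. 3 (proof)] -/
theorem dual_psiK_two_apply (h2 : 2 ≤ m) (i : Fin m) (hi : 1 ≤ (i : ℕ)) :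
    (psiK m 2).dual i = if (i : ℕ) = 1 then 2 else 0 := by
  have h1 : 1 ≤ m := le_trans one_le_two h2
  rw [psiK, wdual_add, wdual_add, weightDual_sum, weightDual_sum, dual_lastWeight m h2]
  simp only [Pi.add_apply, Finset.sum_apply, weightDual_sum, wdual_nsmul, Pi.smul_apply,
    dual_lastWeight m h2, dual_lastWeight m h1, fundWeight_apply]
  rw [if_neg (show ¬ (i : ℕ) < 1 by omega)]
  by_cases h : (i : ℕ) = 1
  · rw [if_pos h, if_pos (show (i : ℕ) < 2 by omega)]
    simp [Fin.sum_univ_two, Finset.sum_const, Fin.card_Ioi]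
  · rw [if_neg h, if_neg (show ¬ (i : ℕ) < 2 by omega)]
    simp

/-- **The dual coordinates of `psi3` (the partition `(3m-3, 3)`)**: second coordinate `3`, none
beyond. [cite: BurgisserHuttenhainIkenmeyer2017, Prop. 3 (proof)] -/
theorem dual_psi3_apply (h3 : 3 ≤ m) (i : Fin m) (hi : 1 ≤ (i : ℕ)) :
    (psi3 m).dual i = if (i : ℕ) = 1 then 3 else 0 := by
  have h2 : 2 ≤ m := by omega
  have h1 : 1 ≤ m := by omega
  rw [psi3, wdual_add, wdual_add, weightDual_sum, wdual_nsmul, dual_lastWeight m h2]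
  simp only [Pi.add_apply, Finset.sum_apply, wdual_nsmul, Pi.smul_apply, dual_lastWeight m h1,
    fundWeight_apply]
  rw [if_neg (show ¬ (i : ℕ) < 1 by omega)]
  simp only [smul_zero, Finset.sum_const_zero, add_zero]
  by_cases h : (i : ℕ) = 1
  · rw [if_pos h, if_pos (by omega)]
    norm_num
  · rw [if_neg h, if_neg (by omega)]
    norm_num

/-! ### The cone: every polynomial weight, times `2m`, is realised -/

/-- The next coordinate of a weight (zero after the last). [folklore] -/
def nextVal (χ : Weight (Fin m)) (r : Fin m) : ℤ :=
  if h : (r : ℕ) + 1 < m then χ ⟨(r : ℕ) + 1, h⟩ else 0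

/-- The coefficient of `ω_{r+1}` in a weight: `χ_r - χ_{r+1}`. [folklore] -/
def cdiff (χ : Weight (Fin m)) (r : Fin m) : ℤ :=
  χ r - nextVal m χ r

/-- **Every weight is the telescoping combination `∑_r (χ_r - χ_{r+1}) ω_{r+1}` of fundamental
weights.** [folklore] -/
theorem sum_cdiff_smul_fundWeight (χ : Weight (Fin m)) :
    (∑ r : Fin m, cdiff m χ r • fundWeight m ((r : ℕ) + 1)) = χ := by
  funext i
  rw [Finset.sum_apply]
  simp only [Pi.smul_apply, fundWeight_apply, smul_eq_mul, mul_ite, mul_one, mul_zero]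
  -- pass to an `ℕ`-indexed telescoping sum
  set g : ℕ → ℤ := fun n => if h : n < m then χ ⟨n, h⟩ else 0 with hg
  have hcd : ∀ r : Fin m, cdiff m χ r = g r - g ((r : ℕ) + 1) := fun r => by
    simp only [cdiff, nextVal, hg, dif_pos r.2]
  simp_rw [hcd]
  rw [Fin.sum_univ_eq_sum_range (fun n => if (i : ℕ) < n + 1 then g n - g (n + 1) else 0) m,
    ← Finset.sum_filter]
  have hfilter : (Finset.range m).filter (fun n => (i : ℕ) < n + 1) = Finset.Ico (i : ℕ) m := by
    ext n
    simp only [Finset.mem_filter, Finset.mem_range, Finset.mem_Ico]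
    omega
  rw [hfilter, Finset.sum_Ico_eq_sum_range]
  have hassoc : ∀ t : ℕ, g ((i : ℕ) + t + 1) = g ((i : ℕ) + (t + 1)) := fun t => by rw [Nat.add_assoc]
  simp_rw [hassoc]
  rw [Finset.sum_range_sub' (fun t => g ((i : ℕ) + t)), Nat.add_zero, Nat.add_sub_cancel' (le_of_lt i.2)]
  simp only [hg, dif_pos i.2, lt_self_iff_false, dif_neg, not_false_eq_true, sub_zero]

/-- The telescoping coefficients of a polynomial weight are nonnegative. [folklore] -/
theorem cdiff_nonneg {χ : Weight (Fin m)} (hχ : χ.IsPolynomial) (r : Fin m) : 0 ≤ cdiff m χ r := by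
  rw [cdiff, nextVal]
  split_ifs with h
  · exact sub_nonneg.mpr (hχ.1 (Fin.mk_le_mk.mpr (Nat.le_succ _)))
  · rw [sub_zero]
    exact hχ.2 r

/-- The degree of the cone realisation of a polynomial weight. [folklore] -/
def coneDeg (χ : Weight (Fin m)) : ℕ :=
  ∑ r : Fin m, (cdiff m χ r).toNat * (((r : ℕ) + 1) + ((r : ℕ) + 1))

/-- The weight of the cone realisation of a polynomial weight. [folklore] -/
def conePsi (χ : Weight (Fin m)) : Weight (Fin m) :=
  ∑ r : Fin m, (cdiff m χ r).toNat • (2 • (m • lastWeight m ((r : ℕ) + 1)))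

/-- **The dual of the cone weight is `2m · χ`** (for polynomial `χ`). [folklore] -/
theorem dual_conePsi {χ : Weight (Fin m)} (hχ : χ.IsPolynomial) :
    (conePsi m χ).dual = (2 * m) • χ := by
  rw [conePsi, weightDual_sum]
  conv_rhs => rw [← sum_cdiff_smul_fundWeight m χ, Finset.smul_sum]
  refine Finset.sum_congr rfl fun r _ => ?_
  rw [wdual_nsmul, wdual_nsmul, wdual_nsmul,
    dual_lastWeight m (by have := r.2; omega)]
  funext i
  simp only [Pi.smul_apply]
  simp only [nsmul_eq_mul, smul_eq_mul, Nat.cast_mul, Nat.cast_ofNat]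
  rw [Int.toNat_of_nonneg (cdiff_nonneg m hχ r)]
  ring

/-- **The cone, realised**: for a polynomial weight `χ` of `GL_m` (`m ≥ 1`), the weight `conePsi χ`
with dual `2m · χ` is realised in degree `coneDeg χ`, by the product of the cone generators
`(coneGen (r+1))^{2(χ_r - χ_{r+1})}` ("every partition with at most `m` rows is a nonnegative
combination of the `ω_r`"). [cite: BurgisserHuttenhainIkenmeyer2017, §3 (proof of Prop. 2: the rational cone of S(V^n//H_n))] -/
theorem isRealized_conePsi [CharZero k] [NeZero m] (χ : Weight (Fin m)) :
    IsRealized k m (coneDeg m χ) (conePsi m χ) :=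
  IsRealized.prod Finset.univ _ _ fun r _ =>
    (isRealized_coneGen k m (r := (r : ℕ) + 1) (by have := r.2; omega)).pow _

/-- The cone degree of a nonzero polynomial weight is positive. [folklore] -/
theorem coneDeg_pos {χ : Weight (Fin m)} (hχ : χ.IsPolynomial) (h0 : χ ≠ 0) : 0 < coneDeg m χ := by
  by_contra hle
  apply h0
  rw [← sum_cdiff_smul_fundWeight m χ]
  refine Finset.sum_eq_zero fun r _ => ?_
  have hr : (cdiff m χ r).toNat * (((r : ℕ) + 1) + ((r : ℕ) + 1)) = 0 := by
    have := Finset.single_le_sum (fun r _ => Nat.zero_le _) (Finset.mem_univ r)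
      (f := fun r : Fin m => (cdiff m χ r).toNat * (((r : ℕ) + 1) + ((r : ℕ) + 1)))
    rw [coneDeg] at hle
    omega
  have hc : cdiff m χ r = 0 := by
    have h1 : (cdiff m χ r).toNat = 0 := by
      rcases Nat.mul_eq_zero.mp hr with h | h
      · exact h
      · omega
    have := cdiff_nonneg m hχ r
    omega
  rw [hc, zero_smul]

end Literature.Computability.AlgebraicComplexity
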